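import Summits.Schanuel.Schanuel.Theorems.RootDecomp1KIntegrality01

/-!
# RootDecomp1KIntegrality — lens 1, generation 55, NODE 15 «ODD-PLACE INTEGRALITY (Gauss on the level polynomial)» (RULE K-R45 payable clause; K-R46) — continuation (RootDecomp1KIntegrality02): §3 the engine, §4 the class GaussAt and the theorem, §5 H17P hypothesis-free

(lens-1 g55 NODE 15 HOME kernel K = HOME/decomp-schanuel-lens-1/g55/Integrality.lean 64be435d…, 1006 l, 116 thm + 1 lemma + 10 def, imports tree …RootDecomp1KLocalExponent06 ONLY (no Literature import); Probe / Ctrl0 / Ctrl + NODE-g55.md + SHA256SUMS; CLAIM L2635, crit EX-ANTE PRICE L2637 (ONE THEOREM ×1 under K-R45's payable clause «an infinite class of FRONTIER pairs made unconditional, any input» iff CHECKLIST K-g55; anti-salami: the one credit covers the integrality lever at BOTH ends of the level polynomial; RULE K-R46 pre-announced), census LIVENESS-v5 (GaussAt column) L2636 / crit L2639, NODE L2640 / REQUEST L2641, census STAGING NOTE 5 L2643, critic VERDICT L2642: CLEARED — THEOREM ×1 under K-R45 payable clause (EX-ANTE PRICE L2637), CHECKLIST K-g55 met; RULE K-R46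 FIXED (toolkit of record ∪ Gauss divisibility on levelPoly; amended FRONTIER; tabled conditional-only members at 2 = M17P, L17P); PORT GO (verbatim; docstrings/provenance only; the dedup deletions announced L2643). Port by census-1 gen 22 as `RootDecomp1KIntegrality01–04` (`--supports stmt-Schanuel-33364`; no census credit): 01 = §1 the level polynomial `levelPoly` over ℤ and GAUSS AT THE ODD PLACES — `DomZero`, `leadingCoeff_levelPoly`, **`den_dvd_of_level`** (den r ∣ lc(c₀)·2^(v₂ den r)), `den_le_of_level` + §2 bounded height: `finite_rat_of_abs_le_den_le`, `levels_finite_of_bounded`; 02 = §3 ENGINE `thinFibreAt_of_dom_farClause` / `thinFibreAt_of_dom_slopeCond` (node 14's engine with the root condition DELETED) + §4 the class **`GaussAt m₀ P`** (intrinsic: P ≠ 0 ∧ deg_Y c₀ > deg_Y c_j (1 ≤ j ≤ xdeg P) ∧ SlopeCond) and THE THEOREM **`thinFibreAt_of_gaussAt : GaussAt m₀ P → ThinFibreAt m₀ P`** (every m₀), `gaussAt_xPolyP_iff`, `gaussAt_mono` + §5 the frontier-certified member **`thinFibreAt_H17P_all : 1 ≤ m₀ → ThinFibreAt m₀ H17P`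 HYPOTHESIS-FREE** (node 12's HeightComparison binder removed; `gaussAt_H17P`, `not_localAt_H17P`); 03 = §6 the members `RC2` = x²(Y−1)² + x(Y³−2) + Y⁵ (rational DOUBLE centre) and `GC2` = x²(Y²−17) + x(Y³+Y+1) + (Y⁴+Y³−2) (irrational simple ℚ₂-centres) at m₀ = 2 hyp-free, with their costume tests; 04 = §7 the infinite family `H17D D` + §8 position of the class (`not_gaussAt_L13`, `not_gaussAt_M17P`, …) + §9 bookkeeping ×0 (`GaussOffAt`). PORT EDITS: TWO dedup.landed twins DELETED for the tree decls (head dry-run): K's `finite_rat_of_abs_le_den_le` (≡ `RootDecomp1KLevelFinite.finite_rat_of_abs_le_den_le`, LevelFinite03 — same short name, resolved through K's own `open …LevelFinite`) and K's `partialSum_two_eq` (≡ `RootDecomp1KLevelFinite.lac_partialSum_two`, LevelFinite12 — the one use re-pointed by name); 36 one-line docstrings on undocumented computation lemmas of §6–§7 (statements quoted); otherwise none (K has no private / set_option / cite-token); provenance doc blocks + continuation headers = K's own open-lines; statements and proofs VERBATIM. Rung 0 — nothing here proves Schanuel, 33364, 33363, 31077 or ThinFibre 2; the class and members are HYPOTHESIS-FREE,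 §9 conditional on PadicSubspace / HeightComparison.)
-/

noncomputable section

namespace Summit.Schanuel.Schanuel.Theorems.RootDecomp1KIntegrality

open Polynomial LiouvilleNumber
open scoped Nat
open Summit.Schanuel.Schanuel.Theorems.RootDecomp1KTwoBaseCell (psNumer partialSum_eq_psNumer_div coprime_psNumer)
open Summit.Schanuel.Schanuel.Theorems.RootDecomp1KRelLiouvilleCell (partialSum_two_strictMono)
open Summit.Schanuel.Schanuel.Theorems.RootDecomp1KDegreeLadder
open Summit.Schanuel.Schanuel.Theorems.RootDecomp1KXLinear
open Summit.Schanuel.Schanuel.Theorems.RootDecomp1KXTop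
open Summit.Schanuel.Schanuel.Theorems.RootDecomp1KXAll
open Summit.Schanuel.Schanuel.Theorems.RootDecomp1KLevelFinite
open Summit.Schanuel.Schanuel.Theorems.RootDecomp1KSubspaceBranch
open Summit.Schanuel.Schanuel.Theorems.RootDecomp1KHeightGrading
open Summit.Schanuel.Schanuel.Theorems.RootDecomp1KHeightMachine
open Summit.Schanuel.Schanuel.Theorems.RootDecomp1KLocalExponent

/-! ## §3  THE ENGINE: dominance of `c₀` + the far clause ⟹ `ThinFibreAt m₀` — NO root condition -/

/-- **THE ENGINE (node 14's engine with the root condition DELETED)**: if `deg c_j < deg c₀` for `1 ≤ j ≤ k`, then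
`FarClause m₀ k c → ThinFibreAt m₀ (xPolyP k c)` — for EVERY `m₀`, whatever the roots of the top coefficient `c_k`
in `ℂ₂` (rational or not, in `ℚ₂` or not, of any multiplicity).  The bounded `2`-adic region carries only points of
BOUNDED DENOMINATOR (`den_le_of_level`), i.e. finitely many rationals, each non-degenerate one on finitely many levels. -/
theorem thinFibreAt_of_dom_farClause (k : ℕ) (c : ℕ → ℤ[X]) (hdom : DomZero k c) {m₀ : ℕ}
    (hF : FarClause m₀ k c) : ThinFibreAt m₀ (xPolyP k c) := by
  classical
  by_cases h0 : c 0 = 0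
  · -- then every `c_j = 0`: all points are degenerate, the clause is vacuous
    have hall : ∀ j, j ≤ k → c j = 0 := by
      intro j hj
      rcases Nat.eq_zero_or_pos j with rfl | hjpos
      · exact h0
      · have := hdom j hjpos hj
        rw [h0, natDegree_zero] at this
        exact absurd this (Nat.not_lt_zero _)
    intro C
    refine ⟨0, fun N _ r _ _ hnd => ?_⟩
    exfalso
    obtain ⟨x, hx⟩ := hnd
    apply hx
    rw [bev_xPolyP]
    refine Finset.sum_eq_zero fun j hj => ?_
    have hjk : j ≤ k := by have := Finset.mem_range.mp hj; omega
    rw [hall j hjk, map_zero, mul_zero]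
  obtain ⟨R, hRfar⟩ := hF
  intro C
  obtain ⟨Nfar, hNfar⟩ := hRfar C
  set D : ℝ := max 1 R * |((c 0).leadingCoeff : ℝ)| with hDdef
  obtain ⟨N₃, hN₃⟩ := (levels_finite_of_bounded (xPolyP k c) C D).bddAbove
  refine ⟨Nfar + N₃ + 1, fun N hN r hr hP hnd => ?_⟩
  by_cases hrR : ‖(r : PadicAlgCl 2)‖ ≤ R
  · exfalso
    have hden : (r.den : ℝ) ≤ D := den_le_of_level k c hdom h0 hP hrR
    have hmem : N ∈ ⋃ r ∈ {r : ℚ | |(r : ℝ)| ≤ C ∧ (r.den : ℝ) ≤ D},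
        {N : ℕ | bev (xPolyP k c) (partialSum 2 N) r = 0 ∧ ∃ x : ℝ, bev (xPolyP k c) x r ≠ 0} :=
      Set.mem_biUnion (x := r) ⟨hr, hden⟩ ⟨hP, hnd⟩
    have := hN₃ hmem
    omega
  · push Not at hrR
    exact hNfar N (by omega) r hP hrR

/-- engine + the tree's slope supplier: **dominance + subcritical slopes ⟹ `ThinFibreAt m₀`**. -/
theorem thinFibreAt_of_dom_slopeCond (k : ℕ) (c : ℕ → ℤ[X]) (hB : c k ≠ 0) (hdom : DomZero k c) {m₀ : ℕ}
    (hS : SlopeCond m₀ k c) : ThinFibreAt m₀ (xPolyP k c) :=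
  thinFibreAt_of_dom_farClause k c hdom (farClause_of_slopeCond k c hB hS)

/-- under dominance the `Y`-degree of `xPolyP k c` is `deg c₀` (its `Y`-leading coefficient is the constant `lc(c₀)`). -/
theorem natDegree_xPolyP_of_domZero (k : ℕ) (c : ℕ → ℤ[X]) (hdom : DomZero k c) :
    (xPolyP k c).natDegree = (c 0).natDegree := by
  by_cases h0 : c 0 = 0
  · have hall : ∀ j, j ≤ k → c j = 0 := by
      intro j hj
      rcases Nat.eq_zero_or_pos j with rfl | hjpos
      · exact h0
      · have := hdom j hjpos hj
        rw [h0, natDegree_zero] at this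
        exact absurd this (Nat.not_lt_zero _)
    have : xPolyP k c = 0 := by
      unfold xPolyP
      refine Finset.sum_eq_zero fun j hj => ?_
      have hjk : j ≤ k := by have := Finset.mem_range.mp hj; omega
      rw [hall j hjk, Polynomial.map_zero, mul_zero]
    rw [this, h0, natDegree_zero, natDegree_zero]
  refine le_antisymm (natDegree_xPolyP_le k c _ fun j hj => ?_) (le_natDegree_of_ne_zero fun h => ?_)
  · rcases Nat.eq_zero_or_pos j with rfl | hj1
    · exact le_rfl
    · exact (hdom j hj1 hj).le
  · have := coeff_coeff_xPolyP k c (c 0).natDegree 0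
    rw [h, coeff_zero, if_pos (by simp)] at this
    exact (leadingCoeff_ne_zero.mpr h0) this.symm

/-! ## §4  THE CLASS `GaussAt m₀` (intrinsic) and THE THEOREM -/

/-- **THE ODD-PLACE INTEGRALITY CLASS `GaussAt m₀`** (intrinsic in `P`, via the tree's `xdeg` / `xCoeff`):
`P ≠ 0`, DOMINANCE `deg (xCoeff P j) < deg (xCoeff P 0)` for `1 ≤ j ≤ xdeg P` (the `Y`-leading coefficient of `P`
is a constant of `ℤ[x]`), and node 14's SLOPE CONDITION `SlopeCond m₀ (xdeg P) (xCoeff P)` BY TREE NAME. -/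
def GaussAt (m₀ : ℕ) (P : ℤ[X][X]) : Prop :=
  P ≠ 0 ∧ (∀ j, 1 ≤ j → j ≤ xdeg P → (xCoeff P j).natDegree < (xCoeff P 0).natDegree) ∧
    SlopeCond m₀ (xdeg P) (xCoeff P)

/-- **THE THEOREM (node 15)**: `GaussAt m₀ P → ThinFibreAt m₀ P` — for EVERY `m₀ : ℕ`, NO hypothesis, NO root
condition on the top `x`-coefficient, NO `Prime` / separability / irreducibility proviso. -/
theorem thinFibreAt_of_gaussAt {m₀ : ℕ} {P : ℤ[X][X]} (h : GaussAt m₀ P) : ThinFibreAt m₀ P := by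
  obtain ⟨hP, hdom, hS⟩ := h
  have hB : xCoeff P (xdeg P) ≠ 0 := topX_ne_zero hP
  rw [← xPolyP_xCoeff P]
  exact thinFibreAt_of_dom_slopeCond (xdeg P) (xCoeff P) hB hdom hS

/-- **PRESENTATION LEMMA**: on a presentation `xPolyP k c` with a genuine top (`c k ≠ 0`),
`GaussAt m₀ ↔ DomZero k c ∧ SlopeCond m₀ k c`. -/
theorem gaussAt_xPolyP_iff (k : ℕ) (c : ℕ → ℤ[X]) (hB : c k ≠ 0) {m₀ : ℕ} :
    GaussAt m₀ (xPolyP k c) ↔ DomZero k c ∧ SlopeCond m₀ k c := by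
  have hxc : ∀ j, j ≤ k → xCoeff (xPolyP k c) j = c j := fun j hj => by rw [xCoeff_xPolyP, if_pos hj]
  unfold GaussAt DomZero SlopeCond
  rw [xdeg_xPolyP k c hB]
  constructor
  · rintro ⟨-, hdom, hS⟩
    refine ⟨fun j hj1 hjk => ?_, fun j hj hdj => ?_⟩
    · have := hdom j hj1 hjk
      rwa [hxc j hjk, hxc 0 (Nat.zero_le _)] at this
    · have := hS j hj (by rw [hxc k le_rfl, hxc j hj.le]; exact hdj)
      rwa [hxc k le_rfl, hxc j hj.le] at this
  · rintro ⟨hdom, hS⟩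
    refine ⟨xPolyP_ne_zero hB, fun j hj1 hjk => ?_, fun j hj hdj => ?_⟩
    · rw [hxc j hjk, hxc 0 (Nat.zero_le _)]; exact hdom j hj1 hjk
    · rw [hxc k le_rfl, hxc j hj.le] at hdj ⊢; exact hS j hj hdj

/-- membership from a presentation. -/
theorem gaussAt_xPolyP (k : ℕ) (c : ℕ → ℤ[X]) (hB : c k ≠ 0) {m₀ : ℕ} (hdom : DomZero k c)
    (hS : SlopeCond m₀ k c) : GaussAt m₀ (xPolyP k c) :=
  (gaussAt_xPolyP_iff k c hB).mpr ⟨hdom, hS⟩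

/-- the classes increase with `m₀` (only the slope condition depends on it). -/
theorem gaussAt_mono {m₀ m₁ : ℕ} (hm : m₀ ≤ m₁) {P : ℤ[X][X]} (h : GaussAt m₀ P) : GaussAt m₁ P :=
  ⟨h.1, h.2.1, fun j hj hdj => lt_of_lt_of_le (h.2.2 j hj hdj) (Nat.mul_le_mul_right _ hm)⟩

/-- the `Y`-degree of a member is `deg (xCoeff P 0)`. -/
theorem natDegree_of_gaussAt {m₀ : ℕ} {P : ℤ[X][X]} (h : GaussAt m₀ P) : P.natDegree = (xCoeff P 0).natDegree := by
  conv_lhs => rw [← xPolyP_xCoeff P]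
  exact natDegree_xPolyP_of_domZero _ _ h.2.1

/-- the `x`-degree-`0` edge (`P = c₀(Y)` constant in `x`): such a `P ≠ 0` IS a member at every `m₀` (dominance and
slopes are vacuous) — and the clause holds because every level point is then DEGENERATE (`P(x, r) ≡ 0`), which the
clause's proviso `∃ x, bev P x r ≠ 0` excludes; the engine treats this edge uniformly (no case split in THE THEOREM). -/
theorem gaussAt_of_xdeg_zero {P : ℤ[X][X]} (hP : P ≠ 0) (h0 : xdeg P = 0) (m₀ : ℕ) : GaussAt m₀ P :=
  ⟨hP, fun j hj1 hjk => by omega, fun j hj _ => by omega⟩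

/-! ## §5  THE FRONTIER-CERTIFIED MEMBER `H17P`, NOW HYPOTHESIS-FREE (node 12's binder `HeightComparison` REMOVED) -/

/-- dominance for `H17P = x³(Y² − 17)² + x²Y + x(Y + 1) + Y⁵`: `deg c₀ = 5 > 1, 1, 4`. -/
theorem domZero_h17C : DomZero 3 h17C := by
  intro j hj1 hj3
  rw [h17C_zero, natDegree_X_pow]
  interval_cases j
  · rw [h17C_one, natDegree_X_add_C]; norm_num
  · rw [h17C_two, natDegree_X]; norm_num
  · rw [natDegree_h17C_three]; norm_num

/-- subcritical slopes for `H17P` at every `m₀ ≥ 1`: the only coefficient above the top is `c₀`, `5 − 4 = 1 < 3·m₀`. -/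
theorem slopeCond_h17C {m₀ : ℕ} (hm : 1 ≤ m₀) : SlopeCond m₀ 3 h17C := by
  intro j hj hdj
  rw [natDegree_h17C_three] at hdj ⊢
  interval_cases j
  · rw [h17C_zero, natDegree_X_pow] at hdj ⊢; omega
  · rw [h17C_one, natDegree_X_add_C] at hdj; omega
  · rw [h17C_two, natDegree_X] at hdj; omega

/-- **`H17P ∈ GaussAt m₀` for every `m₀ ≥ 1`.** -/
theorem gaussAt_H17P {m₀ : ℕ} (hm : 1 ≤ m₀) : GaussAt m₀ H17P :=
  gaussAt_xPolyP 3 h17C h17C_three_ne_zero domZero_h17C (slopeCond_h17C hm)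

/-- … and NOT at `m₀ = 0` (the slope condition `1 < 0` fails: no hidden range beyond what `SlopeCond` forces). -/
theorem not_gaussAt_zero_H17P : ¬ GaussAt 0 H17P := by
  intro h
  have := ((gaussAt_xPolyP_iff 3 h17C h17C_three_ne_zero).mp h).2 0 (by norm_num)
    (by rw [h17C_zero, natDegree_X_pow, natDegree_h17C_three]; norm_num)
  rw [h17C_zero, natDegree_X_pow, natDegree_h17C_three] at this
  omega

/-- **THE NAMED TARGET, HYPOTHESIS-FREE: `ThinFibreAt m₀ H17P` for every `m₀ ≥ 1`** (node 12's
`thinFibreAt_two_H17P (hH : HeightComparison)` had the binder; census LIVENESS-v4 row `H17P`: FRONTIER at `m₀ = 2, 3`). -/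
theorem thinFibreAt_H17P_all {m₀ : ℕ} (hm : 1 ≤ m₀) : ThinFibreAt m₀ H17P :=
  thinFibreAt_of_gaussAt (gaussAt_H17P hm)

/-- `ThinFibreAt 2 H17P` — no hypothesis. -/
theorem thinFibreAt_two_H17P' : ThinFibreAt 2 H17P := thinFibreAt_H17P_all (by norm_num)

/-- `ThinFibreAt 3 H17P` — no hypothesis. -/
theorem thinFibreAt_three_H17P' : ThinFibreAt 3 H17P := thinFibreAt_H17P_all (by norm_num)

/-- `ThinFibreAt 1 H17P` — no hypothesis (below every threshold of record). -/
theorem thinFibreAt_one_H17P : ThinFibreAt 1 H17P := thinFibreAt_H17P_all le_rfl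

/-- the top `(Y² − 17)²` is REFUSED by node 14's root condition at every `m₀ ≤ 4`: its root `√17 ∈ ℚ₂` is
IRRATIONAL and DOUBLE — branch (i) fails (`√17 ∈ ℚ₂`), (ii) fails (`√17 ∉ ℚ`), (iii) needs `2·2 + 1 = 5 ≤ m₀`. -/
theorem not_rootCond_h17C_three {m₀ : ℕ} (hm : m₀ ≤ 4) : ¬ RootCond m₀ (h17C 3) := by
  intro hR
  obtain ⟨z, hz⟩ := exists_padic_root_m17C_two
  have hβ2 : aeval (algebraMap ℚ_[2] (PadicAlgCl 2) z) (m17C 2) = 0 := by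
    rw [← algebraMap_aeval_padic, hz, map_zero]
  have hβroot : aeval (algebraMap ℚ_[2] (PadicAlgCl 2) z) (h17C 3) = 0 := by
    rw [h17C_three_eq_sq, map_pow, hβ2, zero_pow two_ne_zero]
  rcases hR _ hβroot with hi | ⟨q, hq, -⟩ | hiii
  · exact hi z rfl
  · have hq2 : (q : PadicAlgCl 2) ^ 2 = 17 := by
      have := hβ2
      rw [← hq, m17C_two, map_sub, map_pow, aeval_X, aeval_C, sub_eq_zero] at this
      rw [this, eq_intCast, Int.cast_ofNat]
    have hq2' : (q : ℝ) ^ 2 = 17 := by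
      have h' : q ^ 2 = 17 := by exact_mod_cast hq2
      exact_mod_cast congrArg (fun t : ℚ => (t : ℝ)) h'
    have hirr : Irrational (Real.sqrt (17 : ℝ)) := by
      simpa using Nat.Prime.irrational_sqrt (by norm_num : Nat.Prime 17)
    refine hirr.ne_rat |q| ?_
    rw [Rat.cast_abs, ← Real.sqrt_sq_eq_abs, hq2']
  · have hmo : (m17C 2).Monic := by rw [m17C_two]; exact monic_X_pow_sub_C _ two_ne_zero
    have hne : (m17C 2).map (algebraMap ℤ (PadicAlgCl 2)) ≠ 0 := (hmo.map _).ne_zero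
    have h1 : 0 < rootMultiplicity (algebraMap ℚ_[2] (PadicAlgCl 2) z) ((m17C 2).map (algebraMap ℤ (PadicAlgCl 2))) := by
      rw [rootMultiplicity_pos hne, IsRoot.def, eval_map_algebraMap]
      exact hβ2
    have h2 : 2 ≤ rootMult (h17C 3) (algebraMap ℚ_[2] (PadicAlgCl 2) z) := by
      unfold rootMult
      rw [h17C_three_eq_sq, Polynomial.map_pow, pow_two, rootMultiplicity_mul (mul_ne_zero hne hne)]
      omega
    omega

/-- **`H17P ∉ LocalAt m₀` for `m₀ ≤ 4`** (node 14's class says nothing about `H17P` below its threshold `5`). -/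
theorem not_localAt_H17P {m₀ : ℕ} (hm : m₀ ≤ 4) : ¬ LocalAt m₀ H17P := fun h => by
  have hR := rootCond_topX_of_localAt h
  rw [topX_H17P] at hR
  exact not_rootCond_h17C_three hm hR

/-- **COSTUME TEST BY NAME, hypothesis-free**: `H17P` is in NO class decided by the tree at `m₀ = 2`
(`¬ DecidedAt 2`, `¬ SepTopAt 2`, `¬ LocalAt 2`, threshold `5`) and IS decided at `2` by THE THEOREM. -/
theorem H17P_territory' : ¬ DecidedAt 2 H17P ∧ ¬ SepTopAt 2 H17P ∧ ¬ LocalAt 2 H17P ∧ thinThreshold H17P = 5 ∧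
    ThinFibreAt 2 H17P :=
  ⟨not_decidedAt_two_H17P, not_sepTopAt_H17P 2, not_localAt_H17P (by norm_num), thinThreshold_H17P,
    thinFibreAt_two_H17P'⟩

end Summit.Schanuel.Schanuel.Theorems.RootDecomp1KIntegrality

end
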